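import Summits.PneNP.PneNP.Theorems.OneSliceSliceACZeroDefs
import Summits.PneNP.PneNP.Theorems.SliceACZero.Negative.LoadBearing
import Summits.PneNP.PneNP.Theses.OneSlice
import Literature.Computability.Complexity.RossmanMonotoneCliqueProofs
import Literature.Computability.Complexity.ACRealizeConnectives

/-!
# Route OneSlice, crux `SliceACZero` (stmt-PneNP-2835), line `russo-window-ladder`: window arithmetic and the test circuit

The crux-specific (CLIQUE-side) glue of the line, independent of the five analytic stubs:
* `window_eventually` — for `3 ≤ k`, eventually in `n`, every central edge count `j` (`|j − m_k(n)| ≤ m_k(n)^{3/4}`,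
  `m_k(n) = ⌊C(n,2)·n^{-2/(k-1)}⌋₊ = Summit.PneNP.PneNP.Theorems.SliceACZero.Negative.mk n k`) satisfies `j₀ ≤ j`, `n ≤ 5j`,
  `2j ≤ C(n,2)` (this is where `3 ≤ k` and the centrality clause — load-bearing by `Negative.not_innerConcNoWindow` /
  `not_innerConcWindowAbove` — are consumed);
* `size_bound` — `2(s + C(n,k) + 1) + 5 ≤ j^{2(c+k)+8}` for `s ≤ n^c`, `n ≤ 5j`, `j ≥ 5`;
* `exists_xorClique_circuit` — the test circuit `G = [C ≠ CLIQUE_k]` over `acBasis` (`acDepth ≤ d + 4`,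
  `≤ 2(|C| + C(n,k) + 1) + 5` gates; `exists_cliqueDNF_monotoneAC` + the `ACReal` toolkit);
* `sliceAvg_edge_eq`, `prodAvg_edge_eq` — on edge vectors the line's `sliceAvg` / `prodAvg` of `G` are the crux's
  `sliceErr / sliceCard` and `gnpDisagreeProb` (`wt = edgeCount` definitionally, `card_edgeSet_top_fin`).
The crux is closed from these and the C⁺ `sliceIndist` in `OneSliceSliceACZero.lean`.
Skeleton: `Cruxes/SliceACZero/Lines/russo-window-ladder.lean`.
-/

noncomputable section

namespace Summit.PneNP.PneNP.Cruxes.SliceACZero.RussoWindowLadder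

open scoped BigOperators
open Finset Filter Literature.Computability.Complexity
open Summit.PneNP.PneNP.Theorems.SliceACZero.Negative (mk sliceCard sliceErr)

set_option linter.dupNamespace false

/-! ### Window arithmetic -/

/-- **Window arithmetic** (this is where `3 ≤ k` and the centrality clause — load-bearing by the Disproof's
`not_innerConcNoWindow` / `not_innerConcWindowAbove` — are used): eventually in `n`, every central `j`
(`|j − m_k(n)| ≤ m_k(n)^{3/4}`) satisfies `j₀ ≤ j`, `n ≤ 5j` and `2j ≤ C(n,2)`. Proof: `m_k ≥ C(n,2)·n^{-1} − 1 =
(n−3)/2` (`n^{-2/(k-1)} ≥ n^{-1}`), `m_k^{3/4} ≤ m_k/2` once `m_k ≥ 16` (inlined), and `m_k ≤ C(n,2)·n^{-2/(k-1)} ≤ C(n,2)/4`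
eventually. [folklore] -/
theorem window_eventually {k : ℕ} (hk : 3 ≤ k) (j₀ : ℕ) :
    ∀ᶠ n : ℕ in atTop, ∀ j : ℕ, |(j : ℝ) - (mk n k : ℝ)| ≤ (mk n k : ℝ) ^ ((3 : ℝ) / 4) →
      j₀ ≤ j ∧ n ≤ 5 * j ∧ 2 * j ≤ n.choose 2 := by
  have hk1 : (2 : ℝ) ≤ (k : ℝ) - 1 := by
    have : (3 : ℝ) ≤ k := by exact_mod_cast hk
    linarith
  have hαpos : 0 < (2 : ℝ) / ((k : ℝ) - 1) := div_pos two_pos (by linarith)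
  have hα1 : (2 : ℝ) / ((k : ℝ) - 1) ≤ 1 := by rw [div_le_one (by linarith)]; exact hk1
  have hr : Tendsto (fun n : ℕ => (n : ℝ) ^ (-(2 : ℝ) / ((k : ℝ) - 1))) atTop (nhds 0) := by
    have := (tendsto_rpow_neg_atTop hαpos).comp tendsto_natCast_atTop_atTop
    refine this.congr fun n => ?_
    rw [Function.comp_apply, neg_div]
  filter_upwards [hr.eventually (gt_mem_nhds (by norm_num : (0 : ℝ) < 1 / 4)),
    eventually_ge_atTop (max 35 (4 * j₀ + 3))] with n hn4 hn j hj
  have hn35 : 35 ≤ n := (le_max_left _ _).trans hn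
  have hnj₀ : 4 * j₀ + 3 ≤ n := (le_max_right _ _).trans hn
  have hnR : (35 : ℝ) ≤ n := by exact_mod_cast hn35
  have hnpos : (0 : ℝ) < n := by linarith
  have hn0 : (n : ℝ) ≠ 0 := hnpos.ne'
  have hr0 : 0 ≤ (n : ℝ) ^ (-(2 : ℝ) / ((k : ℝ) - 1)) := Real.rpow_nonneg hnpos.le _
  have hN : ((n.choose 2 : ℕ) : ℝ) = n * (n - 1) / 2 := Nat.cast_choose_two (K := ℝ) n
  have hNr0 : 0 ≤ ((n.choose 2 : ℕ) : ℝ) * (n : ℝ) ^ (-(2 : ℝ) / ((k : ℝ) - 1)) :=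
    mul_nonneg (Nat.cast_nonneg _) hr0
  -- `m_k` against `C(n,2) · n^{-2/(k-1)}`
  have hm_le : (mk n k : ℝ) ≤ ((n.choose 2 : ℕ) : ℝ) * (n : ℝ) ^ (-(2 : ℝ) / ((k : ℝ) - 1)) :=
    Nat.floor_le hNr0
  have hm_ge : ((n.choose 2 : ℕ) : ℝ) * (n : ℝ) ^ (-(2 : ℝ) / ((k : ℝ) - 1)) - 1 < (mk n k : ℝ) :=
    Nat.sub_one_lt_floor _
  -- `C(n,2) · n^{-2/(k-1)} ≥ (n-1)/2`
  have hr_ge : (n : ℝ) ^ (-(1 : ℝ)) ≤ (n : ℝ) ^ (-(2 : ℝ) / ((k : ℝ) - 1)) := by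
    refine Real.rpow_le_rpow_of_exponent_le (by linarith) ?_
    rw [neg_div, neg_le_neg_iff]; exact hα1
  have hNr_ge : ((n : ℝ) - 1) / 2 ≤ ((n.choose 2 : ℕ) : ℝ) * (n : ℝ) ^ (-(2 : ℝ) / ((k : ℝ) - 1)) := by
    calc ((n : ℝ) - 1) / 2 = ((n.choose 2 : ℕ) : ℝ) * (n : ℝ) ^ (-(1 : ℝ)) := by
          rw [hN, Real.rpow_neg_one]; field_simp
      _ ≤ _ := mul_le_mul_of_nonneg_left hr_ge (Nat.cast_nonneg _)
  -- `C(n,2) · n^{-2/(k-1)} ≤ C(n,2)/4`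
  have hNr_le : ((n.choose 2 : ℕ) : ℝ) * (n : ℝ) ^ (-(2 : ℝ) / ((k : ℝ) - 1)) ≤ ((n.choose 2 : ℕ) : ℝ) / 4 := by
    have := mul_le_mul_of_nonneg_left hn4.le (Nat.cast_nonneg (n.choose 2) : (0 : ℝ) ≤ _)
    linarith
  have hm16 : (16 : ℝ) ≤ (mk n k : ℝ) := by linarith
  -- `M^{3/4} ≤ M/2` for `M = m_k ≥ 16`
  have h34 : (mk n k : ℝ) ^ ((3 : ℝ) / 4) ≤ (mk n k : ℝ) / 2 := by
    have hM0 : (0 : ℝ) < (mk n k : ℝ) := by linarith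
    have h1 : (mk n k : ℝ) ^ ((3 : ℝ) / 4) = (mk n k : ℝ) * (mk n k : ℝ) ^ (-(1 : ℝ) / 4) := by
      rw [show (3 : ℝ) / 4 = 1 + -(1 : ℝ) / 4 by norm_num, Real.rpow_add hM0, Real.rpow_one]
    have h2 : (mk n k : ℝ) ^ (-(1 : ℝ) / 4) ≤ (16 : ℝ) ^ (-(1 : ℝ) / 4) :=
      Real.rpow_le_rpow_of_nonpos (by norm_num) hm16 (by norm_num)
    have h3 : (16 : ℝ) ^ (-(1 : ℝ) / 4) = 1 / 2 := by
      have h16 : (16 : ℝ) = (2 : ℝ) ^ (4 : ℝ) := by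
        rw [show (4 : ℝ) = ((4 : ℕ) : ℝ) by norm_num, Real.rpow_natCast]; norm_num
      rw [h16, ← Real.rpow_mul (by norm_num : (0 : ℝ) ≤ 2),
        show (4 : ℝ) * (-(1 : ℝ) / 4) = -1 by norm_num, Real.rpow_neg_one]
      norm_num
    rw [h1]
    calc (mk n k : ℝ) * (mk n k : ℝ) ^ (-(1 : ℝ) / 4) ≤ (mk n k : ℝ) * (1 / 2) := by
          rw [← h3]; exact mul_le_mul_of_nonneg_left h2 hM0.le
      _ = (mk n k : ℝ) / 2 := by ring
  obtain ⟨hj1, hj2⟩ := abs_sub_le_iff.1 hj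
  have hjlo : (mk n k : ℝ) / 2 ≤ j := by linarith
  have hjhi : (j : ℝ) ≤ 3 * (mk n k : ℝ) / 2 := by linarith
  refine ⟨?_, ?_, ?_⟩
  · have h' : ((4 * j₀ + 3 : ℕ) : ℝ) ≤ n := by exact_mod_cast hnj₀
    push_cast at h'
    have : (j₀ : ℝ) ≤ j := by linarith
    exact_mod_cast this
  · have : (n : ℝ) ≤ 5 * j := by linarith
    exact_mod_cast this
  · have : (2 * j : ℝ) ≤ ((n.choose 2 : ℕ) : ℝ) := by linarith
    exact_mod_cast this

/-- Size bookkeeping for the test circuit: `2(s + C(n,k) + 1) + 5 ≤ j^{2(c+k)+8}` when `s ≤ n^c`,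
`n ≤ 5j`, `j ≥ 5`, `n ≥ 2`. [folklore] -/
theorem size_bound {n j c k s : ℕ} (hn : 2 ≤ n) (hj : 5 ≤ j) (hnj : n ≤ 5 * j) (hs : s ≤ n ^ c) :
    2 * (s + (n.choose k + 1)) + 5 ≤ j ^ (2 * (c + k) + 8) := by
  have h1 : n.choose k ≤ n ^ k := Nat.choose_le_pow n k
  have hn1 : 1 ≤ n := by omega
  have hck : n ^ c ≤ n ^ (c + k) := Nat.pow_le_pow_right hn1 (by omega)
  have hkc : n ^ k ≤ n ^ (c + k) := Nat.pow_le_pow_right hn1 (by omega)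
  have h0 : 1 ≤ n ^ (c + k) := Nat.one_le_pow _ _ hn1
  have h11 : 2 * (s + (n.choose k + 1)) + 5 ≤ 11 * n ^ (c + k) := by omega
  have h16 : 16 ≤ n ^ 4 := by
    have := Nat.pow_le_pow_left hn 4
    simpa using this
  have hstep : 11 * n ^ (c + k) ≤ n ^ (c + k + 4) := by
    calc 11 * n ^ (c + k) ≤ 16 * n ^ (c + k) := by omega
      _ ≤ n ^ 4 * n ^ (c + k) := Nat.mul_le_mul_right _ h16
      _ = n ^ (c + k + 4) := by ring
  have hn_le : n ^ (c + k + 4) ≤ (5 * j) ^ (c + k + 4) := Nat.pow_le_pow_left hnj _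
  have h5j : 5 * j ≤ j * j := Nat.mul_le_mul_right j hj
  have hjj : (5 * j) ^ (c + k + 4) ≤ (j * j) ^ (c + k + 4) := Nat.pow_le_pow_left h5j _
  have hfin : (j * j) ^ (c + k + 4) = j ^ (2 * (c + k) + 8) := by
    rw [← pow_two, ← pow_mul, show 2 * (c + k + 4) = 2 * (c + k) + 8 by ring]
  omega

/-! ### The test circuit and the read-back of the two averages on edge vectors -/

variable {n : ℕ}

/-- **The test circuit `G = [C ≠ CLIQUE_k]`** over `acBasis`: `acDepth ≤ d + 4`, `≤ 2(|C| + C(n,k) + 1) + 5` gates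
(`(C ∧ ¬K) ∨ (¬C ∧ K)` with `K` the exhaustive clique DNF `exists_cliqueDNF_monotoneAC`; `ACReal` toolkit). [folklore] -/
theorem exists_xorClique_circuit (k : ℕ) {d : ℕ} (C : Circuit ((⊤ : SimpleGraph (Fin n)).edgeSet)) (hC : C.IsOver acBasis)
    (hd : C.acDepth ≤ d) :
    ∃ G : Circuit ((⊤ : SimpleGraph (Fin n)).edgeSet), G.IsOver acBasis ∧ G.acDepth ≤ d + 4 ∧
      G.size ≤ 2 * (C.size + (n.choose k + 1)) + 5 ∧ ∀ x, G.eval x = (C.eval x != cliqueFn n k x) := by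
  obtain ⟨K, hKB, hKd, hKs, hKe⟩ := exists_cliqueDNF_monotoneAC n k
  have hCr : ACReal C.eval (max d 2) C.size :=
    (ACReal.of_circuit C hC hd le_rfl).mono (le_max_left _ _) le_rfl
  have hKr : ACReal (cliqueFn n k) (max d 2) (n.choose k + 1) :=
    ((ACReal.of_circuit K (hKB.mono monotoneACBasis_subset_acBasis)
      ((acDepth_le_depth K).trans hKd) hKs).congr hKe).mono (le_max_right _ _) le_rfl
  have h1 := acReal_and hCr hKr.neg
  have h2 := acReal_and hCr.neg hKr
  have h3 := acReal_or h1 h2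
  have h4 : ACReal (fun x => (C.eval x != cliqueFn n k x)) (max d 2 + 1 + 1)
      (C.size + (n.choose k + 1 + 1) + 1 + (C.size + 1 + (n.choose k + 1) + 1) + 1) :=
    h3.congr fun x => by
      cases hc : C.eval x <;> cases hq : cliqueFn n k x <;> simp
  obtain ⟨G, hGB, hGd, hGs, hGe⟩ := h4.toCircuit
  exact ⟨G, hGB, hGd.trans (by omega), hGs.trans (by omega), hGe⟩

/-- On edge vectors the slice average of `G = [C ≠ K]` is the Disproof's `sliceErr / sliceCard`
(`wt = edgeCount` definitionally). [folklore] -/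
theorem sliceAvg_edge_eq (j : ℕ) {C K G : (((⊤ : SimpleGraph (Fin n)).edgeSet) → Bool) → Bool} (hG : ∀ x, G x = (C x != K x)) :
    sliceAvg G j = (sliceErr n j C K : ℝ) / (sliceCard n j : ℝ) := by
  have hnum : (univ.filter fun x : ((⊤ : SimpleGraph (Fin n)).edgeSet) → Bool => wt x = j ∧ G x = true) =
      (univ.filter fun x : ((⊤ : SimpleGraph (Fin n)).edgeSet) → Bool => edgeCount x = j ∧ C x ≠ K x) := by
    refine Finset.filter_congr fun x _ => ?_
    rw [hG x]
    exact and_congr Iff.rfl bne_iff_ne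
  have hden : (univ.filter fun x : ((⊤ : SimpleGraph (Fin n)).edgeSet) → Bool => wt x = j) =
      (univ.filter fun x : ((⊤ : SimpleGraph (Fin n)).edgeSet) → Bool => edgeCount x = j) := rfl
  unfold sliceAvg sliceErr sliceCard
  rw [hnum, hden]

/-- On edge vectors the `μ_q`-average of `G = [C ≠ K]` is `gnpDisagreeProb n q C K`. [folklore] -/
theorem prodAvg_edge_eq (q : ℝ) {C K G : (((⊤ : SimpleGraph (Fin n)).edgeSet) → Bool) → Bool} (hG : ∀ x, G x = (C x != K x)) :
    prodAvg q G = gnpDisagreeProb n q C K := by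
  have hfil : (univ.filter fun x : ((⊤ : SimpleGraph (Fin n)).edgeSet) → Bool => G x = true) =
      (univ.filter fun x : ((⊤ : SimpleGraph (Fin n)).edgeSet) → Bool => C x ≠ K x) :=
    Finset.filter_congr fun x _ => by rw [hG x]; exact bne_iff_ne
  unfold prodAvg gnpDisagreeProb
  rw [hfil]
  refine Finset.sum_congr rfl fun x _ => ?_
  rw [prodWeight, gnpWeight, card_edgeSet_top_fin]
  rfl

end Summit.PneNP.PneNP.Cruxes.SliceACZero.RussoWindowLadder

end
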